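import Literature.AnabelianGeometry.EtaleTheta.Discharge.Sec3Cor38Criterion
import Literature.AnabelianGeometry.EtaleTheta.TemperedFrobenioidToy
import Literature.AlgebraicGeometry.Frobenioids.PiNatMonoid
import Literature.AlgebraicGeometry.Frobenioids.MonoidTransport
import Literature.AlgebraicGeometry.Frobenioids.ModelFrobenioidIsFrobenioid
import Literature.AlgebraicGeometry.Frobenioids.ArchimedeanPointBase
import HarnessLib

/-!
# [EtTh] Corollary 3.8 (i) sub-DAG — row C38-L05: the row is NOT derivable over the typed Def. 3.3/3.6 (i) data
# (kernel witness for plan/GAP-LEDGER.md G-w5d124-2)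

Mochizuki, *The étale theta function …*, Publ. RIMS **45** (2009), Def. 3.6 (i)/(ii) PDF pp.76–77 and the proof of
Cor. 3.8, p.81 l.20–27 [cite: MochizukiEtTh2009, Cor 3.8 p.81].  abc-iut cell, layer L2, seat abc-iut-w5-d124;
companion of `Sec3Cor38Criterion.lean` (p422576), which proves row C38-L05
(`TemperedFrobenioid.BsFldPreStepLimitCriterion C (PreFrobenioidData.perfection hF)`) MODULO three printed
properties of the Def. 3.3/3.6 (i) data (`hP34Λ`, `hNZ`, `hSup`) that the typed interface `RealifiedDivisorMonoids`
(abc-iut-L2-t3) does not record.  This file certifies in the kernel that SOME such hypothesis is NECESSARY: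

* `Cor38Toy.C` — an inhabitant of the typed interface stack `DivisorMonoids` / `RealifiedDivisorMonoids` /
  `TemperedFrobenioid` (over the trivial [FrdI] vocabularies of `TemperedFrobenioidToy.lean`) with
  `Φ₀ = Φ^{ℝ-log} = Φ = ℤ_{≥0}³ = ⟨P, Q, R⟩` (real `PiNat` monoid, divisorial), `B₀^Λ = ℤ·b₀` with
  `div(b₀) = P − Q`, `F₀^Λ = B₀^Λ`, and `ℝ·Φ₀^cnst := {g | g_P + g_Q = 0} ⊇ {P − Q, R}` — so that `Φ^{bs-fld} = ℤ_{≥0}·R`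
  IS monoprime and condition (b) of Def. 3.6 (ii) holds AS TYPED (`div(b₀) = P/Q`, `P ≠ Q`), while the PRINTED
  consequence "the image of `F(A) → (Φ^{bs-fld})^gp(A)` contains a nonzero element of `Φ^{bs-fld}(A)`" FAILS
  (`P − Q` is neither effective nor anti-effective) — together with `Cor38Toy.isFrobenioid : IsFrobenioid C.toElem`
  ([FrdI] Thm. 5.2 (ii), L1 `ModelFrobenioid.isFrobenioid`, over REAL divisoriality of `ℤ_{≥0}³`);
* `Cor38Toy.divO_eq` — in this model no rational function has a nontrivial effective divisor (`O^▷ ≡ 1`);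
* **`Cor38Toy.not_bsFldPreStepLimitCriterion`** — the pre-step with zero divisor `R` is base-field-theoretic but,
  by parts (a)–(c) of the landed reduction (`Cor38Criterion.isLimitOfOTriLike_iff_isLUB_divOPf`), its image in `C^pf`
  is a limit of O^▷-like pre-steps only if `R^{1/1} ∣ 1`; hence `¬ C.BsFldPreStepLimitCriterion (perfection hF)`;
* `Cor38Toy.not_forall_bsFldPreStepLimitCriterion` — so row C38-L05 is not a theorem of the typed structure alone.
Classification (cell vocabulary): the ROW is faithful to print; the gap is a SCHEMA gap of the typed Def. 3.3/3.6 (i)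
data (GAP-LEDGER G-w5d124-1/2/3).  HONEST FRAMING: a consistency/independence witness about typed interfaces;
refereed pre-IUT material; nothing here bears on [IUTchIII] Cor. 3.12.
-/

noncomputable section

namespace Literature.AnabelianGeometry.EtaleTheta

open CategoryTheory Opposite Literature.AlgebraicGeometry.Frobenioids

namespace Cor38Toy

/-! ### §1 The monoid `ℤ_{≥0}³ = ⟨P, Q, R⟩` and the "constant line" character `g ↦ g_P + g_Q` -/

/-- The divisor monoid `ℤ_{≥0}³` (multiplicative notation; L1 `PiNat`). [cite: MochizukiEtTh2009, Def 3.3 p.73] -/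
abbrev M : Type := Multiplicative (Fin 3 → ℕ)

/-- The three primes `P, Q, R`. [cite: MochizukiEtTh2009, Def 3.3 p.73] -/
def e (j : Fin 3) : M := PiNat.single j 1

/-- The additive character `f ↦ f_P + f_Q` of `ℤ_{≥0}³`, valued in `ℤ`. [cite: MochizukiEtTh2009, Def 3.6 p.76] -/
def χ : M →* Multiplicative ℤ :=
  (((Nat.castAddMonoidHom ℤ).comp
    ((Pi.evalAddMonoidHom (fun _ : Fin 3 => ℕ) 0) + (Pi.evalAddMonoidHom (fun _ : Fin 3 => ℕ) 1)))).toMultiplicative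

/-- `χ` on a coordinate vector. [cite: MochizukiEtTh2009, Def 3.6 p.76] -/
theorem χ_apply (f : M) :
    χ f = Multiplicative.ofAdd (((Multiplicative.toAdd f 0 : ℕ) : ℤ) + ((Multiplicative.toAdd f 1 : ℕ) : ℤ)) := by
  rfl

/-- `χ(P) = χ(Q) = 1`, `χ(R) = 0` (additively). [cite: MochizukiEtTh2009, Def 3.6 p.76] -/
theorem χ_e (j : Fin 3) : χ (e j) = Multiplicative.ofAdd (if j = 2 then (0 : ℤ) else 1) := by
  rw [χ_apply]
  congr 1
  fin_cases j <;> simp [e, PiNat.single]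

/-- The character on the groupification `(ℤ_{≥0}³)^gp → ℤ`. [cite: MochizukiEtTh2009, Def 3.6 p.76] -/
def ψ : Algebra.GrothendieckGroup M →* Multiplicative ℤ := Algebra.GrothendieckGroup.lift χ

/-- `ψ` extends `χ`. [cite: MochizukiEtTh2009, Def 3.6 p.76] -/
theorem ψ_of (f : M) : ψ (Algebra.GrothendieckGroup.of f) = χ f := by
  have h := Algebra.GrothendieckGroup.lift.symm_apply_apply χ
  rw [Algebra.GrothendieckGroup.lift_symm_apply] at h
  exact DFunLike.congr_fun h f

/-- The divisor `P − Q` of the "uniformiser" `b₀`. [cite: MochizukiEtTh2009, Def 3.3 p.73] -/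
def g₀ : Algebra.GrothendieckGroup M := Algebra.GrothendieckGroup.of (e 0) / Algebra.GrothendieckGroup.of (e 1)

/-- `ψ(P − Q) = 0`. [cite: MochizukiEtTh2009, Def 3.6 p.76] -/
theorem ψ_g₀ : ψ g₀ = 1 := by
  rw [g₀, map_div, ψ_of, ψ_of, χ_e, χ_e]
  simp

/-- `div : ℤ → (ℤ_{≥0}³)^gp`, `n ↦ n·(P − Q)`. [cite: MochizukiEtTh2009, Def 3.3 p.73] -/
def divHom : Multiplicative ℤ →* Algebra.GrothendieckGroup M := zpowersHom _ g₀

/-- `divHom 1 = P − Q`. [cite: MochizukiEtTh2009, Def 3.3 p.73] -/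
theorem divHom_ofAdd_one : divHom (Multiplicative.ofAdd 1) = g₀ := by
  rw [divHom, zpowersHom_apply, toAdd_ofAdd, zpow_one]

/-- Every divisor of a "rational function" lies on the line `ψ = 0`. [cite: MochizukiEtTh2009, Def 3.6 p.76] -/
theorem ψ_divHom (b : Multiplicative ℤ) : ψ (divHom b) = 1 := by
  rw [divHom, zpowersHom_apply, map_zpow, ψ_g₀, one_zpow]

/-- `gpMap id = id`, pointwise. [folklore] -/
private theorem gpMap_id_apply {N : Type} [CommMonoid N] (x : Algebra.GrothendieckGroup N) :
    gpMap (MonoidHom.id N) x = x :=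
  DFunLike.congr_fun (Literature.AlgebraicGeometry.Frobenioids.gpMap_id (M := N)) x

/-! ### §2 The typed data: Def. 3.3 (iii), Def. 3.6 (i), Def. 3.6 (ii) -/

/-- Def. 3.3 (iii) data of the model: `Φ₀ = ℤ_{≥0}³`, `B₀ = ℤ`, `div₀ = (n ↦ n·(P − Q))`, `F₀ = B₀` (all constant),
nothing cuspidal, over the one-object base category. [cite: MochizukiEtTh2009, Def 3.3 p.73] -/
def divisorMonoids : DivisorMonoids.{0, 0, 0} (Discrete PUnit.{1}) where
  Φ₀ := (Functor.const _).obj (CommMonCat.of M)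
  B₀ := (Functor.const _).obj (CommMonCat.of (Multiplicative ℤ))
  isUnit_B₀ _ b := by
    change IsUnit (M := Multiplicative ℤ) b
    exact Group.isUnit _
  div₀ _ := divHom
  div₀_natural _ b := (gpMap_id_apply (divHom b)).symm
  F₀ _ := ⊤
  F₀_map _ _ _ := trivial
  ncsp₀ _ := ⊤
  csp₀ _ := ⊥
  ncsp₀_map _ _ _ := trivial
  csp₀_map _ x hx := by
    rw [Submonoid.mem_bot] at hx ⊢
    rw [hx, map_one]
  existsUnique_ncsp_csp _ x := by
    refine ⟨(⟨x, trivial⟩, ⟨1, Submonoid.mem_bot.mpr rfl⟩), mul_one x, ?_⟩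
    rintro ⟨a, c⟩ h
    have hc : c.1 = 1 := Submonoid.mem_bot.mp c.2
    have ha : a.1 = x := by
      have h' : a.1 * c.1 = x := h
      rwa [hc, mul_one] at h'
    exact Prod.ext (Subtype.ext ha) (Subtype.ext hc)

/-- Def. 3.6 (i) data of the model (`Λ = ℤ`, `Φ₀^ℝ = Φ₀`, `B₀^Λ = B₀`, `F₀^Λ = B₀^Λ`) with
`ℝ·Φ₀^cnst := Ker(ψ) = {g | g_P + g_Q = 0}` — a root-closed subgroup containing `div(F₀^Λ) = ℤ·(P − Q)` and the image
of `Φ₀^cnst`, as the typed fields demand, but also the EFFECTIVE element `R` and the non-comparable `P − Q`.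
[cite: MochizukiEtTh2009, Def 3.6 p.76] -/
def realified : RealifiedDivisorMonoids (D₀ := Discrete PUnit.{1}) Toy.monoidVocab where
  toDivisorMonoids := divisorMonoids
  Λ := MonoidType.Z
  ΦR := (Functor.const _).obj (CommMonCat.of M)
  toR _ := MonoidHom.id _
  toR_natural _ _ := rfl
  isRealification _ := trivial
  BΛ := (Functor.const _).obj (CommMonCat.of (Multiplicative ℤ))
  isUnit_BΛ _ b := by
    change IsUnit (M := Multiplicative ℤ) b
    exact Group.isUnit _
  divΛ _ := divHom
  divΛ_natural _ b := (gpMap_id_apply (divHom b)).symm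
  FΛ _ := ⊤
  FΛ_map _ _ _ := trivial
  cnstR _ := ψ.ker
  cnstR_map _ x hx := by
    show ψ (gpMap (MonoidHom.id M) x) = 1
    rw [gpMap_id_apply]
    exact hx
  divΛ_mem_cnstR _ b _ := by
    show ψ (divHom b) = 1
    exact ψ_divHom b
  cnstR_root _ g n hg := by
    have hg' : ψ g ^ (n : ℕ) = 1 := by rw [← map_pow]; exact hg
    have h : (n : ℕ) • Multiplicative.toAdd (ψ g) = 0 := by
      have := congrArg Multiplicative.toAdd hg'
      rwa [toAdd_pow, toAdd_one] at this
    show ψ g = 1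
    rcases smul_eq_zero.mp h with h | h
    · exact absurd h n.ne_zero
    · exact congrArg Multiplicative.ofAdd h
  cnst_le_cnstR _ b _ := by
    show ψ (gpMap (MonoidHom.id M) (divHom b)) = 1
    rw [gpMap_id_apply]
    exact ψ_divHom b
  ncspR _ := ⊤
  cspR _ := ⊥
  toR_ncsp _ _ _ := trivial
  toR_csp _ _ hx := hx

/-- The base-field-theoretic submonoid `{f | f_P + f_Q = 0}` of `ℤ_{≥0}³` is `ℤ_{≥0}·R ≅ ℤ_{≥0}`: the isomorphism
`f ↦ f_R`. [cite: MochizukiEtTh2009, Def 3.6 p.77] -/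
def bsFldEquiv :
    ↥((⊤ : Submonoid M) ⊓ (ψ.ker).toSubmonoid.comap Algebra.GrothendieckGroup.of) ≃* Multiplicative ℕ where
  toFun f := Multiplicative.ofAdd (Multiplicative.toAdd f.1 2)
  invFun k := ⟨PiNat.single 2 (Multiplicative.toAdd k), Submonoid.mem_top _, by
    change Algebra.GrothendieckGroup.of (PiNat.single (2 : Fin 3) (Multiplicative.toAdd k) : M) ∈ ψ.ker
    rw [MonoidHom.mem_ker, ψ_of, χ_apply]
    simp [PiNat.single]⟩
  left_inv f := by
    obtain ⟨f, -, hf⟩ := f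
    apply Subtype.ext
    change (PiNat.single (2 : Fin 3) (Multiplicative.toAdd f 2) : M) = f
    have hf' : ψ (Algebra.GrothendieckGroup.of f) = 1 := hf
    rw [ψ_of, χ_apply] at hf'
    have h01 : ((Multiplicative.toAdd f 0 : ℕ) : ℤ) + ((Multiplicative.toAdd f 1 : ℕ) : ℤ) = 0 :=
      Multiplicative.ofAdd.injective hf'
    have h0 : Multiplicative.toAdd f 0 = 0 := by omega
    have h1 : Multiplicative.toAdd f 1 = 0 := by omega
    apply PiNat.ext
    intro j
    fin_cases j
    · simpa [PiNat.coeff, PiNat.single] using h0.symm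
    · simpa [PiNat.coeff, PiNat.single] using h1.symm
    · simp [PiNat.coeff, PiNat.single]
  right_inv k := by simp [PiNat.single]
  map_mul' f g := by
    change Multiplicative.ofAdd (Multiplicative.toAdd (f.1 * g.1) 2) = _
    rw [toAdd_mul, Pi.add_apply, ofAdd_add]

/-- **The typed tempered-Frobenioid interface is satisfied** by the model: `D = D₀` one object, `Φ = Φ^{ℝ-log} = ℤ_{≥0}³`
(group-saturated), `Φ^{bs-fld} ≅ ℤ_{≥0}` monoprime (REAL `IsMonoprime`), and Def. 3.6 (ii)(b) AS TYPED: the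
constant `b₀` has the nonzero divisor `P/Q` with `P ≠ Q ∈ Φ`. [cite: MochizukiEtTh2009, Def 3.6 p.77] -/
def C : TemperedFrobenioid realified (Discrete PUnit.{1}) Toy.catVocab where
  isConnected := zigzag_isConnected fun j₁ j₂ => by rw [Subsingleton.elim j₁ j₂]
  isTotallyEpimorphic := ⟨fun f => ⟨fun _ _ _ => Subsingleton.elim _ _⟩⟩
  base := 𝟭 _
  Φ := ⟨fun _ => ⊤, fun _ _ _ => trivial⟩
  isGroupSaturated A := (isGroupSaturated_iff' _).2 fun _ _ _ _ _ _ => trivial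
  isPerfFactorial _ := trivial
  isDivisorialOn := trivial
  isMonoprime_bsFld _ := IsMonoprime.ofZ ⟨⟨bsFldEquiv⟩⟩
  exists_FΛ_div_ne _ := ⟨(Multiplicative.ofAdd (1 : ℤ) : Multiplicative ℤ), trivial, e 0, trivial, e 1, trivial,
    fun h => by
      have := congrArg (fun f : M => Multiplicative.toAdd f 0) h
      simp [e, PiNat.single] at this,
    divHom_ofAdd_one⟩

/-! ### §3 The model is a genuine Frobenioid ([FrdI] Thm. 5.2 (ii)) -/

/-- On the one-object base category every pull-back map of any monoid is the identity.
[cite: MochizukiFrdI2008, Def. 1.1 (ii) p.19] -/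
theorem pull_id_punit (Φ : (Discrete PUnit.{1})ᵒᵖ ⥤ CommMonCat.{0})
    (α : (⟨PUnit.unit⟩ : Discrete PUnit.{1}) ⟶ ⟨PUnit.unit⟩) (x : Φ.obj (op ⟨PUnit.unit⟩)) :
    pull Φ α x = x := by
  obtain rfl : α = 𝟙 _ := Subsingleton.elim _ _
  change (Φ.map (𝟙 (op (⟨PUnit.unit⟩ : Discrete PUnit.{1})))).hom x = x
  rw [Φ.map_id]
  rfl

/-- Hence every monoid on the one-object category is a monoid on `D` in the sense of [FrdI] Def. 1.1 (ii).
[cite: MochizukiFrdI2008, Def. 1.1 (ii) p.19] -/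
theorem isMonoidOn_of_punit (Φ : (Discrete PUnit.{1})ᵒᵖ ⥤ CommMonCat.{0}) : IsMonoidOn Φ where
  isCharInjective := by
    rintro ⟨⟨⟩⟩ ⟨⟨⟩⟩ α
    have hid : pull Φ α = MonoidHom.id _ := MonoidHom.ext fun x => pull_id_punit Φ α x
    refine ⟨fun x y h => by rwa [hid] at h, fun x y hxy => ?_⟩
    obtain ⟨a', rfl⟩ := Associates.mk_surjective x
    obtain ⟨b', rfl⟩ := Associates.mk_surjective y
    rw [associatesMap_mk, associatesMap_mk, hid] at hxy
    exact hxy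
  bijective_of_isFSM := by
    rintro ⟨⟨⟩⟩ ⟨⟨⟩⟩ α _
    have hid : pull Φ α = MonoidHom.id _ := MonoidHom.ext fun x => pull_id_punit Φ α x
    rw [hid]
    exact Function.bijective_id

/-- The divisor monoid `Φ = ℤ_{≥0}³` (as the full submonoid) is divisorial (L1 `PiNat.isDivisorial` transported).
[cite: MochizukiFrdI2008, Def. 1.1 (i) p.19] -/
theorem isDivisorial_Φ : Objectwise (fun N _ => IsDivisorial N) C.divisorMonoid := fun _ =>
  IsDivisorial.of_mulEquiv (Submonoid.topEquiv (M := M)).symm PiNat.isDivisorial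

/-- **The model is a Frobenioid** ([FrdI] Thm. 5.2 (ii) for the model Frobenioid of its data; L1
`ModelFrobenioid.isFrobenioid`; the one-object base is connected and totally epimorphic — L1's
`ArchFrd.pt_isGraphConnected`, `PadicFrd.isTotallyEpimorphic_discretePUnit`). [cite: MochizukiFrdI2008, Thm. 5.2 (ii) p.101] -/
theorem isFrobenioid : PreFrobenioid.IsFrobenioid C.toElem :=
  ModelFrobenioid.isFrobenioid (isMonoidOn_of_punit _) isDivisorial_Φ (isMonoidOn_of_punit _)
    C.ratFnFunctor_isGroupLike_holds ArchFrd.pt_isGraphConnected PadicFrd.isTotallyEpimorphic_discretePUnit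

/-! ### §4 No rational function has a nontrivial effective divisor: `O^▷ ≡ 1` -/

/-- The `j`-th coordinate character `(ℤ_{≥0}³)^gp → ℤ`. [cite: MochizukiEtTh2009, Def 3.6 p.76] -/
def π (j : Fin 3) : Algebra.GrothendieckGroup M →* Multiplicative ℤ :=
  Algebra.GrothendieckGroup.lift (((Nat.castAddMonoidHom ℤ).comp (Pi.evalAddMonoidHom (fun _ : Fin 3 => ℕ) j)).toMultiplicative)

/-- `π j` on `of f` is the coordinate `f_j`. [cite: MochizukiEtTh2009, Def 3.6 p.76] -/
theorem π_of (j : Fin 3) (f : M) : π j (Algebra.GrothendieckGroup.of f) = Multiplicative.ofAdd ((Multiplicative.toAdd f j : ℕ) : ℤ) := by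
  have h := Algebra.GrothendieckGroup.lift.symm_apply_apply
    (((Nat.castAddMonoidHom ℤ).comp (Pi.evalAddMonoidHom (fun _ : Fin 3 => ℕ) j)).toMultiplicative)
  rw [Algebra.GrothendieckGroup.lift_symm_apply] at h
  exact DFunLike.congr_fun h f

/-- `π_P(P − Q) = 1`, `π_Q(P − Q) = −1` (additively). [cite: MochizukiEtTh2009, Def 3.6 p.76] -/
theorem toAdd_π_g₀ : Multiplicative.toAdd (π 0 g₀) = 1 ∧ Multiplicative.toAdd (π 1 g₀) = -1 := by
  constructor <;>
  · rw [g₀, map_div, π_of, π_of, toAdd_div, toAdd_ofAdd, toAdd_ofAdd]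
    simp [e, PiNat.single]

/-- In the model, `divO C W = {1}`: if `n·(P − Q) = Div Z` with `Z` effective then `n = 0` and `Z = 0` (compare the
`P`- and `Q`-coordinates). [cite: MochizukiEtTh2009, Cor 3.8 p.81] -/
theorem eq_one_of_mem_divO {W : Discrete PUnit.{1}} {Z : C.Φ.carrier (op W)} (hZ : Z ∈ C.divO W) : Z = 1 := by
  obtain ⟨⟨⟩⟩ := W
  obtain ⟨u, hu⟩ := hZ
  set b : Multiplicative ℤ := u.1.1 with hb
  -- `u = (b, ξ)` with `divΛ b = ξ` in `(Φ^{ℝ-log})^gp` and `ξ = Div Z`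
  have h1 : divHom b =
      gpMap (C.Φ.carrier (op ⟨PUnit.unit⟩)).subtype (Algebra.GrothendieckGroup.of Z) := by
    have := u.2
    change divHom u.1.1 = gpMap (C.Φ.carrier (op ⟨PUnit.unit⟩)).subtype u.1.2 at this
    rw [this]
    exact congrArg _ hu
  rw [gpMap_of, divHom, zpowersHom_apply] at h1
  have h1M : g₀ ^ Multiplicative.toAdd b = Algebra.GrothendieckGroup.of (M := M) (Z.1 : M) := h1
  -- compare `P`- and `Q`-coordinates
  have h0 := congrArg (fun t => Multiplicative.toAdd (π 0 t)) h1M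
  have h1' := congrArg (fun t => Multiplicative.toAdd (π 1 t)) h1M
  simp only [map_zpow, toAdd_zpow, toAdd_π_g₀.1, toAdd_π_g₀.2, π_of, toAdd_ofAdd, smul_eq_mul, mul_one,
    mul_neg] at h0 h1'
  have hn : Multiplicative.toAdd b = 0 := by omega
  rw [hn, zpow_zero] at h1M
  haveI := isIntegral_iff_isCancelMul.mp (PiNat.isDivisorial (J := Fin 3)).isPreDivisorial.isIntegral
  have hZ1 : (Z.1 : M) = 1 :=
    Algebra.GrothendieckGroup.of_injective (M := M) (h1M.symm.trans (map_one _).symm)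
  exact Subtype.ext hZ1

/-- Hence `divOPf C W = {1}`. [cite: MochizukiEtTh2009, Cor 3.8 p.81] -/
theorem eq_one_of_mem_divOPf {W : Discrete PUnit.{1}} {y : Perfection (C.divisorMonoid.obj (op W))}
    (hy : y ∈ C.divOPf W) : y = 1 := by
  obtain ⟨Z, N, hZ, rfl⟩ := hy
  rw [eq_one_of_mem_divO hZ]
  exact Perfection.mk_one N

/-! ### §5 The counterexample -/

/-- The unique object of the base category. [cite: MochizukiEtTh2009, Def 3.6 p.77] -/
abbrev pt : Discrete PUnit.{1} := ⟨PUnit.unit⟩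

/-- The effective divisor `R ∈ Φ(•)`. [cite: MochizukiEtTh2009, Def 3.6 p.77] -/
def R : C.divisorMonoid.obj (op pt) := (⟨e 2, Submonoid.mem_top _⟩ : (⊤ : Submonoid M))

/-- The Frobenius-trivial object `A₀ = (•, 0)` of the model Frobenioid. [cite: MochizukiFrdI2008, Thm. 5.2 (i) p.100] -/
abbrev A₀ : C.category := ⟨pt, 1⟩

/-- The object `B₀ = (•, R)`. [cite: MochizukiFrdI2008, Thm. 5.2 (i) p.100] -/
abbrev B₀ : C.category := ⟨pt, Algebra.GrothendieckGroup.of R⟩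

/-- The pre-step `φ = (1, id, R, 1) : (•, 0) → (•, R)` with zero divisor `R`. [cite: MochizukiFrdI2008, Thm. 5.2 (i) p.100] -/
def φ : A₀ ⟶ B₀ where
  degFr := 1
  base := 𝟙 pt
  div := R
  unit := 1
  rel := by
    show (1 : Algebra.GrothendieckGroup (C.divisorMonoid.obj (op pt))) ^ ((1 : ℕ+) : ℕ) *
        Algebra.GrothendieckGroup.of R =
      pullGp C.divisorMonoid (𝟙 pt) (Algebra.GrothendieckGroup.of R) *
        divB C.divisorMonoid C.ratFnFunctor C.divBNatTrans (op pt) 1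
    rw [one_pow, one_mul, map_one, mul_one, pullGp_id]

/-- `φ` is a pre-step. [cite: MochizukiFrdI2008, Def. 1.2 (iii) p.22] -/
theorem isPreStep_φ : C.opsData.IsPreStep φ :=
  ⟨rfl, by change IsIso (𝟙 pt); infer_instance⟩

/-- `φ` is base-field-theoretic: `R` lies on the typed line `ℝ·Φ₀^cnst = {g | g_P + g_Q = 0}`.
[cite: MochizukiEtTh2009, Def 3.6 p.78] -/
theorem isBaseFieldTheoretic_φ : C.IsBaseFieldTheoretic φ := by
  refine ⟨trivial, ?_⟩
  change Algebra.GrothendieckGroup.of (e 2) ∈ ψ.ker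
  rw [MonoidHom.mem_ker, ψ_of, χ_e]
  rfl

/-- `R ≠ 0`. [cite: MochizukiEtTh2009, Def 3.6 p.77] -/
theorem R_ne_one : R ≠ 1 := fun h => by
  have h1 : Multiplicative.toAdd (R.1 : M) 2 = 1 := by
    show (Pi.single (2 : Fin 3) (1 : ℕ) : Fin 3 → ℕ) 2 = 1
    exact Pi.single_eq_same _ _
  have h2 : (R.1 : M) = 1 := congrArg Subtype.val h
  rw [h2] at h1
  exact zero_ne_one h1

/-- **Row C38-L05 FAILS for the model**: `φ` is a base-field-theoretic pre-step whose image in `C^pf` is NOT a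
cofiltered limit of O^▷-like pre-steps (by the landed reduction, such a limit forces `R^{1/1} ∣ 1`).
[cite: MochizukiEtTh2009, Cor 3.8 p.81] -/
theorem not_bsFldPreStepLimitCriterion : ¬ C.BsFldPreStepLimitCriterion (PreFrobenioidData.perfection isFrobenioid) := by
  intro h
  have hψ : (PreFrobenioidData.perfection isFrobenioid).ops.IsCoAngularPreStep
      ((PreFrobenioidData.perfection isFrobenioid).toPf.map φ) :=
    Cor38Criterion.isCoAngularPreStep_of_isPreStep
      (PreFrobenioid.Perfection.preservesMor_isPreStep isFrobenioid φ isPreStep_φ)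
  have hlim := (h φ isPreStep_φ).mp isBaseFieldTheoretic_φ
  rw [Cor38Criterion.isLimitOfOTriLike_iff_isLUB_divOPf _ hψ,
    TemperedFrobenioid.sliceDiv_toPf isFrobenioid φ isPreStep_φ.2 hψ] at hlim
  obtain ⟨S, hS, -, -, -, hlub⟩ := hlim
  have hdvd : Perfection.of _ (PreFrobenioid.invDiv C.toElem φ isPreStep_φ.2) ∣ 1 :=
    hlub 1 fun s hs => by rw [eq_one_of_mem_divOPf (hS hs)]
  -- `R^{1/1} ∣ 1` in the sharp monoid `Φ(•)^pf` forces `R = 1`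
  have hsharp : IsSharp (Perfection (C.divisorMonoid.obj (op (PreFrobenioid.baseObj C.toElem B₀)))) :=
    ((isDivisorial_Φ (PreFrobenioid.baseObj C.toElem B₀)).perfection).isSharp
  have h1' : Perfection.of _ (PreFrobenioid.invDiv C.toElem φ isPreStep_φ.2) = 1 :=
    hsharp.1 _ (isUnit_of_dvd_one hdvd)
  have h1 : PreFrobenioid.invDiv C.toElem φ isPreStep_φ.2 = 1 :=
    (Perfection.mk_eq_one_iff_of_isSharp (isDivisorial_Φ (PreFrobenioid.baseObj C.toElem B₀)).isSharp).mp h1'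
  -- `(φ^*)⁻¹ Div φ = R` (the base of `φ` is the identity)
  have h2 : PreFrobenioid.invDiv C.toElem φ isPreStep_φ.2 = R :=
    PreFrobenioid.Perfection.invDiv_eq_of_pull_eq φ isPreStep_φ.2 (by
      change pull C.divisorMonoid (𝟙 _) R = R
      rw [pull_id])
  exact R_ne_one (h2 ▸ h1)

/-- **Row C38-L05 is not derivable from the typed interfaces alone**: over the trivial [FrdI] vocabularies there are
typed tempered Frobenioids (with genuine Frobenioid structure) for which it fails — the kernel witness behind the
cell's GAP-LEDGER rows G-w5d124-1/2/3 (the positive theorem `TemperedFrobenioid.bsFldPreStepLimitCriterion_of`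
therefore carries its three printed binders). [cite: MochizukiEtTh2009, Cor 3.8 p.81] -/
theorem not_forall_bsFldPreStepLimitCriterion :
    ¬ ∀ (T : RealifiedDivisorMonoids (D₀ := Discrete PUnit.{1}) Toy.monoidVocab)
        (C' : TemperedFrobenioid T (Discrete PUnit.{1}) Toy.catVocab) (hF : PreFrobenioid.IsFrobenioid C'.toElem),
        C'.BsFldPreStepLimitCriterion (PreFrobenioidData.perfection hF) :=
  fun h => not_bsFldPreStepLimitCriterion (h realified C isFrobenioid)

end Cor38Toy

end Literature.AnabelianGeometry.EtaleTheta
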